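import Mathlib
import Summits.Ventures.PercRepro2.Defs
import Summits.Ventures.PercRepro2.Independence
import Summits.Ventures.PercRepro2.Harris
import Summits.Ventures.PercRepro2.Graph

/-!
# The partition law of three vertices is log-supermodular on `Π₃` (blind cell PercRepro2, mine-a g19;
MINE-A.md §66.2, lemma (P1))

For finite bond percolation (admissible weights `IsProbVec p`) and three vertices `a b c`, write
`ab := connEvent ends a b` etc.  The **Harris chain**

`P(a↔b, a↔c) · P(a↮b, a↮c) ≥ P(a↔b) · P(b↔c, a↮b, a↮c)`

(`partitionThree_chain`) follows from three elementary facts: on `{a ↔ b}` the event `{b ↔ c}`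
forces `{a ↔ c}` (`conn_trans`), Harris–FKG for the two increasing events `{a ↔ b}`, `{b ↔ c}`, and
Harris–FKG in mixed form for the increasing `{b ↔ c}` against the decreasing `{a ↮ b, a ↮ c}`.
In partition notation it is exactly the lattice condition of the partition lattice `Π₃` at the two
atoms sharing the vertex `b`:

`P(abc) · P(a|b|c) ≥ P(ab|c) · P(bc|a)`   (`partitionThree_lattice`),

with `abc := ab ∩ bc`, `a|b|c := abᶜ ∩ acᶜ ∩ bcᶜ`, `ab|c := ab ∩ acᶜ`, `bc|a := bc ∩ abᶜ`
(the set identities `P(a|b|c) = P(abᶜ ∩ acᶜ) − P(bc ∩ abᶜ ∩ acᶜ)` and `P(ab|c) = P(ab) − P(ab ∩ bc)`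
are the law of total probability, `prob_inter_add_prob_inter_compl`).  Equivalently
`P(abc) · (1 − P(ac|b)) ≥ P(ab) · P(bc)`: Harris for `{a ↔ b}`, `{b ↔ c}` sharpened by the factor
`1 − P(ac|b)`.  One seat (mine-a g19), paper proof MINE-A.md §66.2; nothing about (ZC) is claimed here.
-/

namespace Summit.Ventures.PercRepro2

section PartitionThree

variable {V : Type*} {E : Type*} [Fintype E] [DecidableEq E] {R : Type*} [CommRing R]
  [PartialOrder R] [IsStrictOrderedRing R]

omit [Fintype E] [DecidableEq E] in
/-- On `{a ↔ b}` the event `{b ↔ c}` forces `{a ↔ c}`: `ab ∩ bc ⊆ ab ∩ ac`. -/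
lemma connEvent_inter_subset_trans (ends : E → Sym2 V) (a b c : V) :
    connEvent ends a b ∩ connEvent ends b c ⊆ connEvent ends a b ∩ connEvent ends a c :=
  fun _ h => ⟨h.1, conn_trans h.1 h.2⟩

omit [Fintype E] [DecidableEq E] in
/-- The avoidance event `{a ↮ b, a ↮ c}` is decreasing. -/
lemma isLowerSet_not_conn_two (ends : E → Sym2 V) (a b c : V) :
    IsLowerSet ((connEvent ends a b)ᶜ ∩ (connEvent ends a c)ᶜ) :=
  (isUpperSet_connEvent ends a b).compl.inter (isUpperSet_connEvent ends a c).compl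

/-- **The Harris chain for three vertices** (lemma (P1), cleared form):
`P(a↔b, a↔c) · P(a↮b, a↮c) ≥ P(a↔b) · P(b↔c, a↮b, a↮c)`. -/
theorem partitionThree_chain {p : E → R} (hp : IsProbVec p) (ends : E → Sym2 V) (a b c : V) :
    prob p (connEvent ends a b) *
        prob p (((connEvent ends a b)ᶜ ∩ (connEvent ends a c)ᶜ) ∩ connEvent ends b c) ≤
      prob p (connEvent ends a b ∩ connEvent ends a c) *
        prob p ((connEvent ends a b)ᶜ ∩ (connEvent ends a c)ᶜ) := by
  set D := (connEvent ends a b)ᶜ ∩ (connEvent ends a c)ᶜ with hD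
  have h1 : prob p (connEvent ends a b ∩ connEvent ends b c) ≤
      prob p (connEvent ends a b ∩ connEvent ends a c) :=
    prob_mono hp (connEvent_inter_subset_trans ends a b c)
  have h2 : prob p (connEvent ends a b) * prob p (connEvent ends b c) ≤
      prob p (connEvent ends a b ∩ connEvent ends b c) :=
    prob_mul_prob_le_prob_inter hp (isUpperSet_connEvent ends a b) (isUpperSet_connEvent ends b c)
  have h3 : prob p (D ∩ connEvent ends b c) ≤ prob p D * prob p (connEvent ends b c) :=
    prob_inter_le_prob_mul_prob_of_isLowerSet hp (isLowerSet_not_conn_two ends a b c)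
      (isUpperSet_connEvent ends b c)
  have hab : 0 ≤ prob p (connEvent ends a b) := prob_nonneg hp _
  have hDn : 0 ≤ prob p D := prob_nonneg hp _
  calc prob p (connEvent ends a b) * prob p (D ∩ connEvent ends b c)
      ≤ prob p (connEvent ends a b) * (prob p D * prob p (connEvent ends b c)) :=
        mul_le_mul_of_nonneg_left h3 hab
    _ = prob p D * (prob p (connEvent ends a b) * prob p (connEvent ends b c)) := by ring
    _ ≤ prob p D * prob p (connEvent ends a b ∩ connEvent ends b c) :=
        mul_le_mul_of_nonneg_left h2 hDn
    _ ≤ prob p D * prob p (connEvent ends a b ∩ connEvent ends a c) :=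
        mul_le_mul_of_nonneg_left h1 hDn
    _ = prob p (connEvent ends a b ∩ connEvent ends a c) * prob p D := by ring

/-- The partition events of three vertices: all together, `ab|c`, `bc|a`, all apart. -/
def partAll (ends : E → Sym2 V) (a b c : V) : Set (Config E) :=
  connEvent ends a b ∩ connEvent ends b c

/-- `ab|c`: `a ↔ b` and `c` in another cluster. -/
def partABc (ends : E → Sym2 V) (a b c : V) : Set (Config E) :=
  connEvent ends a b ∩ (connEvent ends a c)ᶜ

/-- `bc|a`: `b ↔ c` and `a` in another cluster. -/
def partBCa (ends : E → Sym2 V) (a b c : V) : Set (Config E) :=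
  connEvent ends b c ∩ (connEvent ends a b)ᶜ

/-- `a|b|c`: three different clusters. -/
def partApart (ends : E → Sym2 V) (a b c : V) : Set (Config E) :=
  ((connEvent ends a b)ᶜ ∩ (connEvent ends a c)ᶜ) ∩ (connEvent ends b c)ᶜ

/-- `P(ab|c) = P(a↔b) − P(a↔b, a↔c)` (and `ab ∩ ac = ab ∩ bc` as events). -/
lemma prob_partABc {p : E → R} (ends : E → Sym2 V) (a b c : V) :
    prob p (partABc ends a b c) =
      prob p (connEvent ends a b) - prob p (connEvent ends a b ∩ connEvent ends a c) := by
  have h := prob_inter_add_prob_inter_compl p (connEvent ends a b) (connEvent ends a c)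
  unfold partABc
  linear_combination h

omit [Fintype E] [DecidableEq E] in
/-- `bc|a = (abᶜ ∩ acᶜ) ∩ bc` as sets. -/
lemma partBCa_eq (ends : E → Sym2 V) (a b c : V) :
    partBCa ends a b c = ((connEvent ends a b)ᶜ ∩ (connEvent ends a c)ᶜ) ∩ connEvent ends b c := by
  ext ω
  simp only [partBCa, Set.mem_inter_iff, Set.mem_compl_iff, mem_connEvent]
  constructor
  · rintro ⟨hbc, hab⟩
    refine ⟨⟨hab, fun hac => hab ?_⟩, hbc⟩
    exact conn_trans hac (conn_symm hbc)
  · rintro ⟨⟨hab, _⟩, hbc⟩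
    exact ⟨hbc, hab⟩

/-- `P(a|b|c) = P(a↮b, a↮c) − P(bc|a)`. -/
lemma prob_partApart {p : E → R} (ends : E → Sym2 V) (a b c : V) :
    prob p (partApart ends a b c) =
      prob p ((connEvent ends a b)ᶜ ∩ (connEvent ends a c)ᶜ) - prob p (partBCa ends a b c) := by
  have h := prob_inter_add_prob_inter_compl p ((connEvent ends a b)ᶜ ∩ (connEvent ends a c)ᶜ)
    (connEvent ends b c)
  rw [partBCa_eq]
  unfold partApart
  linear_combination h

omit [Fintype E] [DecidableEq E] in
/-- `abc = ab ∩ ac` as events (both say: the three vertices lie in one cluster). -/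
lemma partAll_eq (ends : E → Sym2 V) (a b c : V) :
    partAll ends a b c = connEvent ends a b ∩ connEvent ends a c := by
  ext ω
  simp only [partAll, Set.mem_inter_iff, mem_connEvent]
  constructor
  · rintro ⟨hab, hbc⟩; exact ⟨hab, conn_trans hab hbc⟩
  · rintro ⟨hab, hac⟩; exact ⟨hab, conn_trans (conn_symm hab) hac⟩

/-- **(P1) — the partition law of three vertices is log-supermodular on `Π₃`**:
`P(abc) · P(a|b|c) ≥ P(ab|c) · P(bc|a)` (the lattice condition at the two atoms sharing `b`). -/
theorem partitionThree_lattice {p : E → R} (hp : IsProbVec p) (ends : E → Sym2 V) (a b c : V) :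
    prob p (partABc ends a b c) * prob p (partBCa ends a b c) ≤
      prob p (partAll ends a b c) * prob p (partApart ends a b c) := by
  have hchain := partitionThree_chain hp ends a b c
  rw [← partBCa_eq] at hchain
  rw [partAll_eq, prob_partApart, prob_partABc]
  set x := prob p (connEvent ends a b) with hx
  set y := prob p (connEvent ends a b ∩ connEvent ends a c) with hy
  set z := prob p (partBCa ends a b c) with hz
  set w := prob p ((connEvent ends a b)ᶜ ∩ (connEvent ends a c)ᶜ) with hw
  calc (x - y) * z = x * z - y * z := by ring
    _ ≤ y * w - y * z := sub_le_sub_right hchain _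
    _ = y * (w - z) := by ring

end PartitionThree

end Summit.Ventures.PercRepro2
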